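import Summits.Ventures.PercRepro.C041MultiExitMain

/-!
# ROW C-041 — THE BLOCK MAP IS MULTILINEAR, AND CONJECTURE (BLOCK MAP) REDUCES TO PURE INPUTS (p6, gen 34;
mine-3's C-041.md §20 (c): «since Θ is multilinear and the cone is generated by the pure vectors, the linearised
form is exactly the cone conjecture for weighted zones whose marks are pendant leaves»)

Setting of `C041MultiExitMain`: the block map `blockMap Z₁ u a₁ w` of an unmarked host `Z₁` (anchor `a₁`, exits
`u : ι → V₁`) at the six-vectors `w k` is the sum over the colourings `ω` of `Z₁` of the COLOURING TERM
`colTerm ω w = (∏_{k merged} exitOf (w k) rd_k) · ∏_{B block} θ_R (∏_{k ∈ B} exitOf (w k) rd_k)`.  Every exit `k`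
is merged or lies in exactly one block (`merged_or_mem_blocks`, `disjoint_merged_blocks`, `blocks_pairwise`), so a
colouring term is LINEAR in each slot: `colTerm ω (update w k x) = exitOf x rd_k · C` if `k` is merged and
`= M · (θ_R (exitOf x rd_k · D) · C)` if `k` lies in a block (`colTerm_update_shape`), with `exitOf` and `θ_R`
linear.  Hence the block map is MULTILINEAR (`blockMap_update_add`, `blockMap_update_smul`), and since the cone
`InCone` is generated by the pure roots `V b` under addition and non-negative scaling, **a block map that sends
every family of pure roots into the cone sends every family of cone members into the cone**
(`inCone_blockMap_of_pure`): CONJECTURE (BLOCK MAP) for a host is a statement about stars at its exits.  On the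
attachment: `inCone_sixVec_hang_of_pure`, `zoneOCubeConj_hang_of_pure` (the ZONE O-CUBE at the anchor of
`hang Z₁ u Z a` for cone zones `Z k`, from the pure-input block map of the host).
-/

namespace PercRepro

namespace ZoneZ

namespace MultiExit

open ZoneData Pendant Finset TwoExit TreeClosure

/-! ## `θ_B`, `θ_R` and `exitOf` are linear -/

/-- `θ_B` is additive. -/
theorem thB_add (x y : Vec6) : thB (x + y) = thB x + thB y := by
  funext i
  fin_cases i <;> simp [thB]

/-- `θ_B` is homogeneous. -/
theorem thB_smul (c : ℝ) (x : Vec6) : thB (c • x) = c • thB x := by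
  funext i
  fin_cases i <;> simp [thB]

/-- `θ_R` is additive. -/
theorem thR_add (x y : Vec6) : thR (x + y) = thR x + thR y := by
  funext i
  fin_cases i <;> simp [thR, nAdm, kInv] <;> ring

/-- `θ_R` is homogeneous. -/
theorem thR_smul (c : ℝ) (x : Vec6) : thR (c • x) = c • thR x := by
  funext i
  fin_cases i <;> simp [thR, nAdm, kInv] <;> ring

/-- `exitOf` is additive in the vector. -/
theorem exitOf_add (x y : Vec6) (r : Prop) : exitOf (x + y) r = exitOf x r + exitOf y r := by
  unfold exitOf
  by_cases hr : r
  · rw [if_pos hr, if_pos hr, if_pos hr]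
  · rw [if_neg hr, if_neg hr, if_neg hr, thB_add]

/-- `exitOf` is homogeneous in the vector. -/
theorem exitOf_smul (c : ℝ) (x : Vec6) (r : Prop) : exitOf (c • x) r = c • exitOf x r := by
  unfold exitOf
  by_cases hr : r
  · rw [if_pos hr, if_pos hr]
  · rw [if_neg hr, if_neg hr, thB_smul]

variable {ι V₁ E₁ U₁ U₂ : Type} {V E T₁ T₂ : ι → Type}
variable (Z₁ : ZoneData V₁ E₁ U₁ U₂) (u : ι → V₁) (a₁ : V₁)
variable [Fintype ι] [DecidableEq ι] [Fintype E₁] [DecidableEq E₁]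

/-! ## The colouring terms -/

/-- The contribution of one colouring `ω` of the host to the block map: the product over the merged exits of
`exitOf (w k) rd_k` times, over the blocks, `θ_R` of the product of the block's `exitOf (w k) rd_k`. -/
noncomputable def colTerm (ω : E₁ → Bool) (w : ι → Vec6) : Vec6 :=
  (∏ k ∈ merged Z₁ u a₁ ω, exitOf (w k) (Z₁.Rd a₁ (u k) ω)) *
    ∏ B ∈ blocks Z₁ u a₁ ω, thR (∏ k ∈ B, exitOf (w k) (Z₁.Rd a₁ (u k) ω))

omit [DecidableEq ι] in
/-- The block map is the sum of the colouring terms. -/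
theorem blockMap_eq_sum_colTerm (w : ι → Vec6) : blockMap Z₁ u a₁ w = ∑ ω, colTerm Z₁ u a₁ ω w := rfl

omit [Fintype ι] [Fintype E₁] [DecidableEq E₁] in
/-- The per-exit vectors of an updated family are the update of the per-exit vectors. -/
theorem exitFun_update (ω : E₁ → Bool) (w : ι → Vec6) (k : ι) (x : Vec6) :
    (fun j => exitOf (Function.update w k x j) (Z₁.Rd a₁ (u j) ω)) =
      Function.update (fun j => exitOf (w j) (Z₁.Rd a₁ (u j) ω)) k (exitOf x (Z₁.Rd a₁ (u k) ω)) := by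
  funext j
  by_cases hj : j = k
  · subst hj
    rw [Function.update_self, Function.update_self]
  · rw [Function.update_of_ne hj, Function.update_of_ne hj]

omit [Fintype E₁] [DecidableEq E₁] in
/-- **A colouring term is linear in each slot**: for an exit `k` it is `exitOf x rd_k · C` (`k` merged) or
`M · (θ_R (exitOf x rd_k · D) · C)` (`k` in a block), with `C`, `D`, `M` independent of `x`. -/
theorem colTerm_update_shape (ω : E₁ → Bool) (w : ι → Vec6) (k : ι) :
    (∃ C : Vec6, ∀ x, colTerm Z₁ u a₁ ω (Function.update w k x) = exitOf x (Z₁.Rd a₁ (u k) ω) * C) ∨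
      (∃ M D C : Vec6, ∀ x, colTerm Z₁ u a₁ ω (Function.update w k x) =
        M * (thR (exitOf x (Z₁.Rd a₁ (u k) ω) * D) * C)) := by
  rcases merged_or_mem_blocks Z₁ u a₁ ω k with hk | ⟨B₀, hB₀, hkB₀⟩
  · left
    refine ⟨(∏ j ∈ merged Z₁ u a₁ ω \ {k}, exitOf (w j) (Z₁.Rd a₁ (u j) ω)) *
      ∏ B ∈ blocks Z₁ u a₁ ω, thR (∏ j ∈ B, exitOf (w j) (Z₁.Rd a₁ (u j) ω)), fun x => ?_⟩
    have h1 : (∏ j ∈ merged Z₁ u a₁ ω, exitOf (Function.update w k x j) (Z₁.Rd a₁ (u j) ω)) =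
        exitOf x (Z₁.Rd a₁ (u k) ω) * ∏ j ∈ merged Z₁ u a₁ ω \ {k}, exitOf (w j) (Z₁.Rd a₁ (u j) ω) := by
      rw [exitFun_update, Finset.prod_update_of_mem hk]
    have h2 : ∀ B ∈ blocks Z₁ u a₁ ω,
        (∏ j ∈ B, exitOf (Function.update w k x j) (Z₁.Rd a₁ (u j) ω)) =
          ∏ j ∈ B, exitOf (w j) (Z₁.Rd a₁ (u j) ω) := by
      intro B hB
      have hkB : k ∉ B := Finset.disjoint_left.1 (disjoint_merged_blocks Z₁ u a₁ ω B hB) hk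
      rw [exitFun_update, Finset.prod_update_of_notMem hkB]
    have h2' : (∏ B ∈ blocks Z₁ u a₁ ω, thR (∏ j ∈ B, exitOf (Function.update w k x j) (Z₁.Rd a₁ (u j) ω))) =
        ∏ B ∈ blocks Z₁ u a₁ ω, thR (∏ j ∈ B, exitOf (w j) (Z₁.Rd a₁ (u j) ω)) :=
      Finset.prod_congr rfl fun B hB => by rw [h2 B hB]
    unfold colTerm
    rw [h1, h2', mul_assoc]
  · right
    have hkM : k ∉ merged Z₁ u a₁ ω := fun h =>
      Finset.disjoint_left.1 (disjoint_merged_blocks Z₁ u a₁ ω B₀ hB₀) h hkB₀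
    refine ⟨∏ j ∈ merged Z₁ u a₁ ω, exitOf (w j) (Z₁.Rd a₁ (u j) ω),
      ∏ j ∈ B₀ \ {k}, exitOf (w j) (Z₁.Rd a₁ (u j) ω),
      ∏ B ∈ (blocks Z₁ u a₁ ω).erase B₀, thR (∏ j ∈ B, exitOf (w j) (Z₁.Rd a₁ (u j) ω)), fun x => ?_⟩
    have h1 : (∏ j ∈ merged Z₁ u a₁ ω, exitOf (Function.update w k x j) (Z₁.Rd a₁ (u j) ω)) =
        ∏ j ∈ merged Z₁ u a₁ ω, exitOf (w j) (Z₁.Rd a₁ (u j) ω) := by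
      rw [exitFun_update, Finset.prod_update_of_notMem hkM]
    have h0 : (∏ j ∈ B₀, exitOf (Function.update w k x j) (Z₁.Rd a₁ (u j) ω)) =
        exitOf x (Z₁.Rd a₁ (u k) ω) * ∏ j ∈ B₀ \ {k}, exitOf (w j) (Z₁.Rd a₁ (u j) ω) := by
      rw [exitFun_update, Finset.prod_update_of_mem hkB₀]
    have h2 : ∀ B ∈ (blocks Z₁ u a₁ ω).erase B₀,
        (∏ j ∈ B, exitOf (Function.update w k x j) (Z₁.Rd a₁ (u j) ω)) =
          ∏ j ∈ B, exitOf (w j) (Z₁.Rd a₁ (u j) ω) := by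
      intro B hB
      obtain ⟨hne, hB⟩ := Finset.mem_erase.1 hB
      have hkB : k ∉ B := Finset.disjoint_left.1 (blocks_pairwise Z₁ u a₁ ω B₀ hB₀ B hB hne.symm) hkB₀
      rw [exitFun_update, Finset.prod_update_of_notMem hkB]
    have h2' : (∏ B ∈ (blocks Z₁ u a₁ ω).erase B₀,
        thR (∏ j ∈ B, exitOf (Function.update w k x j) (Z₁.Rd a₁ (u j) ω))) =
          ∏ B ∈ (blocks Z₁ u a₁ ω).erase B₀, thR (∏ j ∈ B, exitOf (w j) (Z₁.Rd a₁ (u j) ω)) :=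
      Finset.prod_congr rfl fun B hB => by rw [h2 B hB]
    unfold colTerm
    rw [h1, ← Finset.mul_prod_erase _ _ hB₀, h0, h2']

omit [Fintype E₁] [DecidableEq E₁] in
/-- A colouring term is additive in each slot. -/
theorem colTerm_update_add (ω : E₁ → Bool) (w : ι → Vec6) (k : ι) (x y : Vec6) :
    colTerm Z₁ u a₁ ω (Function.update w k (x + y)) =
      colTerm Z₁ u a₁ ω (Function.update w k x) + colTerm Z₁ u a₁ ω (Function.update w k y) := by
  rcases colTerm_update_shape Z₁ u a₁ ω w k with ⟨C, hC⟩ | ⟨M, D, C, h⟩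
  · rw [hC, hC, hC, exitOf_add, add_mul]
  · rw [h, h, h, exitOf_add, add_mul, thR_add, add_mul, mul_add]

omit [Fintype E₁] [DecidableEq E₁] in
/-- A colouring term is homogeneous in each slot. -/
theorem colTerm_update_smul (ω : E₁ → Bool) (w : ι → Vec6) (k : ι) (c : ℝ) (x : Vec6) :
    colTerm Z₁ u a₁ ω (Function.update w k (c • x)) = c • colTerm Z₁ u a₁ ω (Function.update w k x) := by
  rcases colTerm_update_shape Z₁ u a₁ ω w k with ⟨C, hC⟩ | ⟨M, D, C, h⟩
  · rw [hC, hC, exitOf_smul, smul_mul_assoc]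
  · rw [h, h, exitOf_smul, smul_mul_assoc, thR_smul, smul_mul_assoc, mul_smul_comm]

/-! ## THE BLOCK MAP IS MULTILINEAR -/

/-- **The block map is additive in each slot.** -/
theorem blockMap_update_add (w : ι → Vec6) (k : ι) (x y : Vec6) :
    blockMap Z₁ u a₁ (Function.update w k (x + y)) =
      blockMap Z₁ u a₁ (Function.update w k x) + blockMap Z₁ u a₁ (Function.update w k y) := by
  simp only [blockMap_eq_sum_colTerm, colTerm_update_add, Finset.sum_add_distrib]

/-- **The block map is homogeneous in each slot.** -/
theorem blockMap_update_smul (w : ι → Vec6) (k : ι) (c : ℝ) (x : Vec6) :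
    blockMap Z₁ u a₁ (Function.update w k (c • x)) = c • blockMap Z₁ u a₁ (Function.update w k x) := by
  simp only [blockMap_eq_sum_colTerm, colTerm_update_smul, Finset.smul_sum]

/-! ## CONJECTURE (BLOCK MAP) REDUCES TO PURE INPUTS -/

/-- **Cone inputs from pure inputs, one slot at a time**: if the block map sends every family that is pure off a
set `s` of slots and in the cone on `s` into the cone, it does so with `s` enlarged by any slot. -/
theorem inCone_blockMap_insert (s : Finset ι) (k : ι) (hks : k ∉ s)
    (ih : ∀ w : ι → Vec6, (∀ j ∈ s, InCone (w j)) →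
      (∀ j, j ∉ s → ∃ (m : ℕ) (b : Fin m → ℝ), (∀ i, 0 ≤ b i ∧ b i ≤ 1) ∧ w j = TreeClosure.V b) →
      InCone (blockMap Z₁ u a₁ w))
    (w : ι → Vec6) (hw : ∀ j ∈ insert k s, InCone (w j))
    (hp : ∀ j, j ∉ insert k s → ∃ (m : ℕ) (b : Fin m → ℝ), (∀ i, 0 ≤ b i ∧ b i ≤ 1) ∧ w j = TreeClosure.V b) :
    InCone (blockMap Z₁ u a₁ w) := by
  have main : ∀ x, InCone x → InCone (blockMap Z₁ u a₁ (Function.update w k x)) := by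
    intro x hx
    induction hx with
    | pure b hb =>
      apply ih
      · intro j hj
        have hjk : j ≠ k := fun h => hks (h ▸ hj)
        rw [Function.update_of_ne hjk]
        exact hw j (Finset.mem_insert_of_mem hj)
      · intro j hj
        by_cases hjk : j = k
        · subst hjk
          exact ⟨_, b, hb, by rw [Function.update_self]⟩
        · rw [Function.update_of_ne hjk]
          exact hp j fun h => (Finset.mem_insert.1 h).elim hjk hj
    | add _ _ ihx ihy =>
      rw [blockMap_update_add]
      exact ihx.add ihy
    | smul c hc _ ihx =>
      rw [blockMap_update_smul]
      exact ihx.smul c hc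
  have := main (w k) (hw k (Finset.mem_insert_self k s))
  rwa [Function.update_eq_self] at this

/-- **CONJECTURE (BLOCK MAP) REDUCES TO PURE INPUTS**: if the block map of the host sends every family of pure
roots `V (b k)` into the cone, it sends every family of cone members into the cone. -/
theorem inCone_blockMap_of_pure
    (hpure : ∀ (m : ι → ℕ) (b : (k : ι) → Fin (m k) → ℝ), (∀ k i, 0 ≤ b k i ∧ b k i ≤ 1) →
      InCone (blockMap Z₁ u a₁ fun k => TreeClosure.V (b k)))
    (w : ι → Vec6) (hw : ∀ k, InCone (w k)) : InCone (blockMap Z₁ u a₁ w) := by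
  have key : ∀ s : Finset ι, ∀ w : ι → Vec6, (∀ j ∈ s, InCone (w j)) →
      (∀ j, j ∉ s → ∃ (m : ℕ) (b : Fin m → ℝ), (∀ i, 0 ≤ b i ∧ b i ≤ 1) ∧ w j = TreeClosure.V b) →
      InCone (blockMap Z₁ u a₁ w) := by
    intro s
    induction s using Finset.induction_on with
    | empty =>
      intro w _ hp
      choose m b hb hwb using fun j => hp j (Finset.notMem_empty j)
      have e : w = fun k => TreeClosure.V (b k) := funext hwb
      rw [e]
      exact hpure m b hb
    | insert k s hks ih => exact inCone_blockMap_insert Z₁ u a₁ s k hks ih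
  exact key Finset.univ w (fun k _ => hw k) fun k hk => absurd (Finset.mem_univ k) hk

/-! ## On the attachment -/

variable (Z : (k : ι) → ZoneData (V k) (E k) (T₁ k) (T₂ k)) (a : (k : ι) → V k)
variable [∀ k, Fintype (E k)] [∀ k, DecidableEq (E k)] [∀ k, Fintype (T₁ k)] [∀ k, DecidableEq (T₁ k)]
  [∀ k, Fintype (T₂ k)] [∀ k, DecidableEq (T₂ k)]

/-- **The six-vector of cone zones hung at the exits lies in the cone as soon as the host's block map sends pure
roots into the cone.** -/
theorem inCone_sixVec_hang_of_pure
    (hpure : ∀ (m : ι → ℕ) (b : (k : ι) → Fin (m k) → ℝ), (∀ k i, 0 ≤ b k i ∧ b k i ≤ 1) →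
      InCone (blockMap Z₁ u a₁ fun k => TreeClosure.V (b k)))
    (hZ : ∀ k, InCone ((Z k).sixVec (a k))) : InCone ((hang Z₁ u Z a).sixVec (Sum.inl a₁)) := by
  rw [sixVec_hang_eq_blockMap]
  exact inCone_blockMap_of_pure Z₁ u a₁ hpure _ hZ

/-- **THE ZONE O-CUBE at the anchor of the attachment of cone zones**, from the pure-input block map of the host. -/
theorem zoneOCubeConj_hang_of_pure
    (hpure : ∀ (m : ι → ℕ) (b : (k : ι) → Fin (m k) → ℝ), (∀ k i, 0 ≤ b k i ∧ b k i ≤ 1) →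
      InCone (blockMap Z₁ u a₁ fun k => TreeClosure.V (b k)))
    (hZ : ∀ k, InCone ((Z k).sixVec (a k))) :
    (hang Z₁ u Z a).ZoneOCubeConj {Sum.inl a₁} (∅ : Set (V₁ ⊕ (Σ k, V k))) :=
  (hang Z₁ u Z a).zoneOCubeConj_of_inCone_sixVec (Sum.inl a₁) (inCone_sixVec_hang_of_pure Z₁ u a₁ Z a hpure hZ)

end MultiExit

end ZoneZ

end PercRepro
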